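import Summits.ABC.IUTFork.Cor312ThetaBoxesDH
import HarnessLib

/-!
# [IUTchIII] Corollary 3.12 — the Dupuy–Hilado PILOT REGIONS READ OFF IDELES for ANY `p`-adic presentation of a
# log-shell signature (sharp reading): the boxes `ι_j(t_{Θ,j,v_j})·(R_I)^∼`, the Θ-centre `λ_Θ`, the `q`-centre `λ_q`

Record file (D-0012) of the abc-iut cell (R2 S-chain team, seat abc-iut-s2-p8; branch C «abc ⇐ S», C-lead ruling
C-R12 (e) «target #2′: the M-level (V̲, K_{v̲}) real volume setting», unit P4 of abc-iut-w5-d166's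
`HOME/staging/w5/w5-d166/g4/G1-THETA-SHAPES.md`). TAKES NO SIDE on [IUTchIII] Cor. 3.12.

abc-iut-c312-3's `Cor312PilotIdelesDH` / `Cor312PilotIdelesCapstone` (p419746, p420764) read the Θ-boxes and the
`q`-centre of the assembled real setting off pilot IDELES (Dupuy–Hilado arXiv:2004.13228 §3.7/§3.9, the SHARP reading
`(𝒪_𝕃(−P_Θ))^{Ind3} := 𝒪_𝕃(−P_Θ)`) for ONE presentation: abc-iut-c312-5's `Real.presAt X hlog pp` of the F-level
signature `Real.logShellsDH X logv` (carriers the completions `F_v` at ALL places of the field `F` of the pilot data).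
The M-LEVEL setting of C-R12 (e) (carriers `K_{v̲}`, `v̲ ∈ V̲ ≅ V_mod`, [IUTchI] Def. 3.1 (e); abc-iut-w5-d166's
`Real.padicPresentationOfInitialDH`, `Cor312VolumesPadicSummandsM` p433804) is ANOTHER inhabitant of abc-iut-c312-1's
GENERIC `Cor312Vol.PadicPresentation L v_ℚ p` (`Cor312VolumesPadicSummands`). THIS file types the per-prime layer of the
sharp pilot regions ONCE, for an ARBITRARY presentation `P : PadicPresentation L v_ℚ p` and ideles
`t_{Θ,i+1,v} ∈ K_v`, `t_{q,v} ∈ K_v` (`v | v_ℚ`), on top of abc-iut-c312-3's generic §1 of `Cor312ThetaBoxesDH`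
(`boxOf`, `centreOf`, `boxOf_smul_normalizedPacket`, `factorMap_preimage_hullSet_centreOf`):

* §1 `labelIdele` (`t_{Θ,j,v}` at `j ≥ 1`, `1` at the label `0`), **`sharpBox t j v⃗ = ι_j(t_{Θ,j,v_j})·(R_I)^∼ ⊆
  K_{v_0} ⊗_{ℚ_p} ⋯ ⊗_{ℚ_p} K_{v_j}`** (Dupuy–Hilado §3.9: the idele acts through the LAST tensor factor, §3.7):
  positive finite measure (`packetAdm_sharpBox`), log-measure `log ‖t_{Θ,j,v_j}‖` (`packetLogμ_sharpBox`, (3.7));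
* §2 the Θ-centre `thetaCentre t j = (ψ_{v⃗}(ι_j(t_{Θ,j,v_j}))_i)_{(v⃗,i)}` with `‖λ_{Θ,(v⃗,i)}‖ = ‖t_{Θ,j,v_j}‖`
  (`norm_thetaCentre`), and **`boxOf (sharpBox t j) = λ_Θ·𝒪_L`** (`boxOf_sharpBox`): every sharp box is a HULL-SET
  ([IUTchIII] Rmk. 3.9.5 (ix): the Θ-pilot object is an arithmetic line bundle), `= 𝒪_L` where the ideles are units
  (`boxOf_sharpBox_eq_hullSet_one`), with admissible preimage in the verbatim container (`adm_preimage_boxOf_sharpBox`);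
* §3 the `q`-centre `qCentre tq j = (ψ_{v⃗}(ι_j(t_{q,v_j}))_i)` (Dupuy–Hilado §3.9: `λ_q·𝒪_L` pulls back to
  `Π_{v⃗} ι_j(t_{q,v_j})·(R_I)^∼ = 𝒪_𝕃(−P_q)_{p,j}`): `qCentre_ne_zero` (`hq`), `factorMap_preimage_hullSet_qCentre`,
  `packetAdm_qBox`, `packetLogμ_qBox = log ‖t_{q,v_j}‖`.

So the assembled settings at BOTH levels (abc-iut-c312-7 `Real.settingPrVolSharp`; the M-level `settingPrVolSharpM`
of unit P4 proper, over abc-iut-w4-d013's `settingPrVolM` / abc-iut-w5-d244's `summandPiecesPrM`) consume one box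
API. [claim: Mochizuki2012, status: disputed] for the quoted setting; [cite: DupuyHilado2025, Def. 3.6.1, §3.4, §3.7,
§3.9, §4.10]; [cite: Mochizuki2012, IUTchIII Rmk. 3.9.5 (ii) p. 127, (ix) (cQ3) p. 141; IUTchIV Prop. 1.4 (i) p. 13].
HONEST FRAMING: bookkeeping over OUR typed objects; nothing here asserts that Cor. 3.12 holds, nor that the sharp
reading is the author's; whether ideles realising a given `P_Θ` exist in `K_v` is an arithmetic condition on the
data (abc-iut-c312-3 `exists_realising_thetaIdeles`; at the M level they are the FIELDS `tΘ`/`tq` of abc-iut-S2's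
`ThetaVolumeInput`). typed ≠ proved; an instance ≠ an endorsement.
-/

noncomputable section

open Set Function
open scoped Pointwise

namespace Summit.ABC

namespace IUTFork

namespace Cor312Vol

namespace PadicPresentation

open Thm311 Cor312 Literature.IUT.LogThetaLattice Literature.IUT.LogVolume

variable {T : ThetaIndex} {L : LogShells T} {vQ : T.VQ} {p : ℕ} [Fact p.Prime] (P : PadicPresentation L vQ p)

/-! ## §1. The label idele and the SHARP Dupuy–Hilado summand region `ι_j(t_{Θ,j,v_j})·(R_I)^∼` -/

section Sharp

variable (t : Fin T.lstar → ∀ x : T.Fibre vQ, P.k x)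

/-- The Θ-idele at the LABEL `j ∈ {0,…,l⋇}`: `t_{Θ,j,v}` for `j ≥ 1`, and `1` at the label `0` (no Θ-pilot component
there; Dupuy–Hilado §3.9 "`𝒪_{v⃗}` in the other degrees"). Generic twin of abc-iut-c312-3's `Real.labelIdele`.
[cite: DupuyHilado2025, §3.9] -/
def labelIdele (j : T.Label) (x : T.Fibre vQ) : P.k x :=
  if h : 0 < (j : ℕ) then t ⟨(j : ℕ) - 1, by have hj : (j : ℕ) < T.lstar + 1 := j.2; omega⟩ x else 1

/-- At the label `j = i+1` the label idele is `t_{Θ,i+1,v}`. [cite: DupuyHilado2025, §3.9] -/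
theorem labelIdele_labelSucc (i : Fin T.lstar) (x : T.Fibre vQ) :
    P.labelIdele t (Setting.labelSucc i) x = t i x := by
  unfold labelIdele
  have h0 : 0 < ((Setting.labelSucc i : T.Label) : ℕ) := by simp [Setting.labelSucc]
  rw [dif_pos h0]
  congr 1

/-- At the label `0` the label idele is `1`. [cite: DupuyHilado2025, §3.9] -/
theorem labelIdele_zero (x : T.Fibre vQ) : P.labelIdele t 0 x = 1 := by
  unfold labelIdele
  rw [dif_neg (by simp)]

/-- The label idele is non-zero when the ideles are. [folklore] -/
theorem labelIdele_ne_zero (ht0 : ∀ i x, t i x ≠ 0) (j : T.Label) (x : T.Fibre vQ) : P.labelIdele t j x ≠ 0 := by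
  unfold labelIdele
  split_ifs
  · exact ht0 _ _
  · exact one_ne_zero

/-- The label idele has norm `1` when the ideles at the corresponding procession index do (and always at the label
`0`). [folklore] -/
theorem norm_labelIdele_eq_one (j : T.Label) (x : T.Fibre vQ)
    (h1 : ∀ i : Fin T.lstar, (i : ℕ) + 1 = (j : ℕ) → ‖t i x‖ = 1) : ‖P.labelIdele t j x‖ = 1 := by
  unfold labelIdele
  split_ifs with h
  · exact h1 _ (by simp; omega)
  · exact norm_one

/-- **The SHARP Dupuy–Hilado summand region** `ι_j(t_{Θ,j,v_j})·(R_I)^∼ ⊆ K_{v_0} ⊗_{ℚ_p} ⋯ ⊗_{ℚ_p} K_{v_j}` — the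
`(p, j, v⃗)`-component of `𝒪_𝕃(−P_Θ)` (Dupuy–Hilado §3.9: the idele acts through the LAST tensor factor, §3.7), taken AS
the (Ind3)-region (the sharp reading). Generic twin of abc-iut-c312-3's `Real.sharpBoxDH` for ANY presentation.
[cite: DupuyHilado2025, §3.7, §3.9] -/
def sharpBox (j : T.Label) (e : T.Caps j → T.Fibre vQ) : Set (P.X e) :=
  iota p (P.kk e) (Fin.last _) (P.labelIdele t j (e (Fin.last _))) • (normalizedPacket p (P.kk e) : Set (P.X e))

/-- The sharp region has positive finite Haar measure (a nondegenerate translate of `(R_I)^∼`).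
[cite: DupuyHilado2025, §3.7] -/
theorem packetAdm_sharpBox (ht0 : ∀ i x, t i x ≠ 0) (j : T.Label) (e : T.Caps j → T.Fibre vQ) :
    PacketAdm p (P.kk e) (P.sharpBox t j e) :=
  packetAdm_iota_smul p _ (Fin.last _) (P.labelIdele_ne_zero t ht0 j _) (packetAdm_normalizedPacket p _)

/-- **(3.7)**: the log-measure of the sharp region is `log ‖t_{Θ,j,v_j}‖`. [cite: DupuyHilado2025, §3.4, §3.7] -/
theorem packetLogμ_sharpBox (ht0 : ∀ i x, t i x ≠ 0) (j : T.Label) (e : T.Caps j → T.Fibre vQ) :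
    packetLogμ p (P.kk e) (P.sharpBox t j e) = Real.log ‖P.labelIdele t j (e (Fin.last _))‖ :=
  packetLogμ_iota_smul_normalizedPacket p _ (Fin.last _) (P.labelIdele_ne_zero t ht0 j _)

/-- (3.7) at the label `j = i+1`: `log μ̄(ι_{i+1}(t_{Θ,i+1,v_{i+1}})·(R_I)^∼) = log ‖t_{Θ,i+1,v_{i+1}}‖`.
[cite: DupuyHilado2025, §3.7] -/
theorem packetLogμ_sharpBox_labelSucc (ht0 : ∀ i x, t i x ≠ 0) (i : Fin T.lstar)
    (e : T.Caps (Setting.labelSucc i) → T.Fibre vQ) :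
    packetLogμ p (P.kk e) (P.sharpBox t (Setting.labelSucc i) e) = Real.log ‖t i (e (Fin.last _))‖ := by
  rw [packetLogμ_sharpBox _ _ ht0, labelIdele_labelSucc]

/-- At the label `0` the sharp region is `(R_I)^∼` itself, of log-measure `0`. [cite: DupuyHilado2025, §3.9] -/
theorem packetLogμ_sharpBox_zero (ht0 : ∀ i x, t i x ≠ 0) (e : T.Caps 0 → T.Fibre vQ) :
    packetLogμ p (P.kk e) (P.sharpBox t 0 e) = 0 := by
  rw [packetLogμ_sharpBox _ _ ht0, labelIdele_zero, norm_one, Real.log_one]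

/-- Where the ideles of the label are units, the sharp region has log-measure `0`. [cite: DupuyHilado2025, §3.9] -/
theorem packetLogμ_sharpBox_eq_zero_of_norm_eq_one (ht0 : ∀ i x, t i x ≠ 0) (j : T.Label)
    (e : T.Caps j → T.Fibre vQ) (h1 : ∀ i : Fin T.lstar, (i : ℕ) + 1 = (j : ℕ) → ‖t i (e (Fin.last _))‖ = 1) :
    packetLogμ p (P.kk e) (P.sharpBox t j e) = 0 := by
  rw [packetLogμ_sharpBox _ _ ht0, P.norm_labelIdele_eq_one t j _ h1, Real.log_one]

/-! ## §2. The Θ-centre `λ_Θ`; every sharp box is the hull-set `λ_Θ·𝒪_L` -/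

/-- **The Θ-centre `λ_Θ ∈ Π_{(v⃗,i)} L_{v⃗,i}`** of the sharp box at the label `j`: `λ_{Θ,(v⃗,i)} = ψ_{v⃗}(ι_j(t_{Θ,j,v_j}))_i`.
[cite: Mochizuki2012, IUTchIII Rmk. 3.9.5 (ii) p. 127] -/
def thetaCentre (j : T.Label) : ∀ s : P.factorIdx j, P.factorField j s :=
  P.centreOf fun e => iota p (P.kk e) (Fin.last _) (P.labelIdele t j (e (Fin.last _)))

/-- The coordinates of the Θ-centre have norm `‖t_{Θ,j,v_j}‖` (`‖ψ_{v⃗}(ι_j(a))_i‖ = ‖a‖`).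
[cite: Mochizuki2012, IUTchIV Prop. 1.4 (i) p. 13] -/
theorem norm_thetaCentre (j : T.Label) (e : T.Caps j → T.Fibre vQ) (i : DIdx p (P.kk e)) :
    ‖P.thetaCentre t j ⟨e, i⟩‖ = ‖P.labelIdele t j (e (Fin.last _))‖ :=
  norm_dEquiv_iota p (P.kk e) (Fin.last _) _ i

/-- Every coordinate of the Θ-centre is non-zero (for non-zero ideles). [cite: Mochizuki2012, IUTchIV Prop. 1.4 (i) p. 13] -/
theorem thetaCentre_ne_zero (ht0 : ∀ i x, t i x ≠ 0) (j : T.Label) (s : P.factorIdx j) : P.thetaCentre t j s ≠ 0 := by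
  obtain ⟨e, i⟩ := s
  exact dEquiv_iota_ne_zero p (P.kk e) (Fin.last _) (P.labelIdele_ne_zero t ht0 j _) i

/-- **The box of the sharp regions IS the hull-set `λ_Θ·𝒪_L`** (box of translated unit balls, abc-iut-c312-3
`boxOf_smul_normalizedPacket`). [cite: Mochizuki2012, IUTchIII Rmk. 3.9.5 (ix) (cQ3) p. 141] -/
theorem boxOf_sharpBox (ht0 : ∀ i x, t i x ≠ 0) (j : T.Label) :
    P.boxOf (P.sharpBox t j) = hullSet (P.factorField j) (P.thetaCentre t j) :=
  P.boxOf_smul_normalizedPacket _ fun e i =>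
    dEquiv_iota_ne_zero p (P.kk e) (Fin.last _) (P.labelIdele_ne_zero t ht0 j _) i

/-- **Every sharp box is a hull-set** ([IUTchIII] Rmk. 3.9.5 (ix): the Θ-pilot object is an arithmetic line bundle).
[cite: Mochizuki2012, IUTchIII Rmk. 3.9.5 (ix) (cQ3) p. 141] -/
theorem isHullSet_boxOf_sharpBox (ht0 : ∀ i x, t i x ≠ 0) (j : T.Label) :
    IsHullSet (P.factorField j) (P.boxOf (P.sharpBox t j)) :=
  ⟨_, P.thetaCentre_ne_zero t ht0 j, P.boxOf_sharpBox t ht0 j⟩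

/-- **Where the Θ-ideles of the label are units, the sharp box is `𝒪_L` itself**: a hull-set depends only on the norms
of its centre, and `‖λ_{Θ,(v⃗,i)}‖ = ‖t_{Θ,j,v_j}‖ = 1` (off the bad places: Dupuy–Hilado's "`𝒪_{v⃗}` at the good
places"; [IUTchIV] Thm. 1.10 Step (vi)). [cite: DupuyHilado2025, §3.9] -/
theorem boxOf_sharpBox_eq_hullSet_one (ht0 : ∀ i x, t i x ≠ 0) (j : T.Label)
    (h1 : ∀ (i : Fin T.lstar) (x : T.Fibre vQ), (i : ℕ) + 1 = (j : ℕ) → ‖t i x‖ = 1) :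
    P.boxOf (P.sharpBox t j) = hullSet (P.factorField j) (fun _ => 1) := by
  rw [P.boxOf_sharpBox t ht0]
  show polydisc _ _ = polydisc _ _
  congr 1
  funext s
  obtain ⟨e, i⟩ := s
  rw [norm_one, norm_thetaCentre, P.norm_labelIdele_eq_one t j _ fun i hi => h1 i _ hi]

/-- The same at the label `j = i+1` from `‖t_{Θ,i+1,v}‖ = 1` on the fibre. [cite: DupuyHilado2025, §3.9] -/
theorem boxOf_sharpBox_labelSucc_eq_hullSet_one (ht0 : ∀ i x, t i x ≠ 0) (i : Fin T.lstar)
    (h1 : ∀ x : T.Fibre vQ, ‖t i x‖ = 1) :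
    P.boxOf (P.sharpBox t (Setting.labelSucc i)) = hullSet (P.factorField (Setting.labelSucc i)) (fun _ => 1) := by
  refine P.boxOf_sharpBox_eq_hullSet_one t ht0 _ fun i' x hi' => ?_
  have : i' = i := by
    apply Fin.ext
    have h := hi'
    simp only [Setting.labelSucc, Fin.val_succ] at h
    omega
  subst this
  exact h1 x

/-- The preimage of the box of the sharp regions under the field-factor comparison is the `e`-preimage of their direct
product over the summands (abc-iut-c312-3 `factorMap_preimage_boxOf`). [cite: Mochizuki2012, IUTchIII Rmk. 3.1.1 (iii) p. 96] -/
theorem factorMap_preimage_boxOf_sharpBox (j : T.Label) :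
    (fun x => P.factorMap j x) ⁻¹' P.boxOf (P.sharpBox t j) = P.comparison j ⁻¹' Set.pi univ (P.sharpBox t j) :=
  P.factorMap_preimage_boxOf _

/-- **`hθ` at the prime**: the preimage of the box of the sharp regions is ADMISSIBLE in the verbatim container of the
presentation (a direct product over the summands of sets of positive finite measure). [claim: Mochizuki2012, status: disputed] -/
theorem adm_preimage_boxOf_sharpBox (ht0 : ∀ i x, t i x ≠ 0) (j : T.Label) :
    P.toLocalPieces.Adm j ((fun x => P.factorMap j x) ⁻¹' P.boxOf (P.sharpBox t j)) :=
  P.adm_preimage_boxOf (P.packetAdm_sharpBox t ht0 j)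

/-- The weighted log-measure of the sharp regions at the label `j = i+1` is `Σ_{v⃗} w(v⃗)·log ‖t_{Θ,i+1,v_{i+1}}‖`
(Dupuy–Hilado (3.7) summand by summand; the weights are the presentation's). [cite: DupuyHilado2025, §3.6, §3.7] -/
theorem sum_w_mul_packetLogμ_sharpBox_labelSucc (ht0 : ∀ i x, t i x ≠ 0) (i : Fin T.lstar) :
    haveI : Fintype (T.Caps (Setting.labelSucc i) → T.Fibre vQ) := Fintype.ofFinite _
    ∑ e : T.Caps (Setting.labelSucc i) → T.Fibre vQ, P.w _ e * packetLogμ p (P.kk e) (P.sharpBox t _ e) =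
      ∑ e : T.Caps (Setting.labelSucc i) → T.Fibre vQ, P.w _ e * Real.log ‖t i (e (Fin.last _))‖ :=
  Finset.sum_congr rfl fun e _ => by rw [P.packetLogμ_sharpBox_labelSucc t ht0]

/-- Where the Θ-ideles at the index `i` are units on the fibre, that weighted log-measure vanishes.
[cite: DupuyHilado2025, §3.9] -/
theorem sum_w_mul_packetLogμ_sharpBox_labelSucc_eq_zero (ht0 : ∀ i x, t i x ≠ 0) (i : Fin T.lstar)
    (h1 : ∀ x : T.Fibre vQ, ‖t i x‖ = 1) :
    haveI : Fintype (T.Caps (Setting.labelSucc i) → T.Fibre vQ) := Fintype.ofFinite _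
    ∑ e : T.Caps (Setting.labelSucc i) → T.Fibre vQ, P.w _ e * packetLogμ p (P.kk e) (P.sharpBox t _ e) = 0 := by
  rw [P.sum_w_mul_packetLogμ_sharpBox_labelSucc t ht0]
  exact Finset.sum_eq_zero fun e _ => by rw [h1, Real.log_one, mul_zero]

end Sharp

/-! ## §3. The `q`-centre `λ_q` read off `q`-pilot ideles -/

section QCentre

variable (tq : ∀ x : T.Fibre vQ, P.k x)

/-- **The Dupuy–Hilado `q`-centre `λ_q ∈ Π_{(v⃗,i)} L_{v⃗,i}`** read off `q`-pilot ideles `t_{q,v} ∈ K_v^×`: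
`λ_{q,(v⃗,i)} = ψ_{v⃗}(ι_j(t_{q,v_j}))_i`, so that `λ_q·𝒪_L` pulls back to `Π_{v⃗} ι_j(t_{q,v_j})·(R_I)^∼`, the
`(p, j, v⃗)`-components of `𝒪_𝕃(−P_q)` (Dupuy–Hilado §3.9). Generic twin of abc-iut-c312-3's `Real.qCentreDH` at a
prime. [cite: DupuyHilado2025, §3.9] -/
def qCentre (j : T.Label) : ∀ s : P.factorIdx j, P.factorField j s :=
  P.centreOf fun e => iota p (P.kk e) (Fin.last _) (tq (e (Fin.last _)))

/-- The coordinates of the `q`-centre have norm `‖t_{q,v_j}‖`. [cite: Mochizuki2012, IUTchIV Prop. 1.4 (i) p. 13] -/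
theorem norm_qCentre (j : T.Label) (e : T.Caps j → T.Fibre vQ) (i : DIdx p (P.kk e)) :
    ‖P.qCentre tq j ⟨e, i⟩‖ = ‖tq (e (Fin.last _))‖ :=
  norm_dEquiv_iota p (P.kk e) (Fin.last _) _ i

/-- **`hq`**: every coordinate of the `q`-centre is non-zero (for non-zero ideles).
[cite: Mochizuki2012, IUTchIV Prop. 1.4 (i) p. 13] -/
theorem qCentre_ne_zero (htq0 : ∀ x, tq x ≠ 0) (j : T.Label) (s : P.factorIdx j) : P.qCentre tq j s ≠ 0 := by
  obtain ⟨e, i⟩ := s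
  exact dEquiv_iota_ne_zero p (P.kk e) (Fin.last _) (htq0 _) i

/-- **`λ_q·𝒪_L` pulls back to the direct product `Π_{v⃗} ι_j(t_{q,v_j})·(R_I)^∼`** (abc-iut-c312-3
`factorMap_preimage_hullSet_centreOf`). [cite: DupuyHilado2025, §3.9] -/
theorem factorMap_preimage_hullSet_qCentre (htq0 : ∀ x, tq x ≠ 0) (j : T.Label) :
    (fun x => P.factorMap j x) ⁻¹' hullSet (P.factorField j) (P.qCentre tq j) =
      P.comparison j ⁻¹' Set.pi univ fun e =>
        iota p (P.kk e) (Fin.last _) (tq (e (Fin.last _))) • (normalizedPacket p (P.kk e) : Set (P.X e)) :=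
  P.factorMap_preimage_hullSet_centreOf _ fun e i => dEquiv_iota_ne_zero p (P.kk e) (Fin.last _) (htq0 _) i

/-- The `q`-box `ι_j(t_{q,v_j})·(R_I)^∼` of a summand has positive finite measure. [cite: DupuyHilado2025, §3.7] -/
theorem packetAdm_qBox (htq0 : ∀ x, tq x ≠ 0) (j : T.Label) (e : T.Caps j → T.Fibre vQ) :
    PacketAdm p (P.kk e)
      (iota p (P.kk e) (Fin.last _) (tq (e (Fin.last _))) • (normalizedPacket p (P.kk e) : Set (P.X e))) :=
  packetAdm_iota_smul p _ (Fin.last _) (htq0 _) (packetAdm_normalizedPacket p _)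

/-- **(3.7)**: the log-measure of the `q`-box of a summand is `log ‖t_{q,v_j}‖`. [cite: DupuyHilado2025, §3.7, §3.9] -/
theorem packetLogμ_qBox (htq0 : ∀ x, tq x ≠ 0) (j : T.Label) (e : T.Caps j → T.Fibre vQ) :
    packetLogμ p (P.kk e)
      (iota p (P.kk e) (Fin.last _) (tq (e (Fin.last _))) • (normalizedPacket p (P.kk e) : Set (P.X e))) =
      Real.log ‖tq (e (Fin.last _))‖ :=
  packetLogμ_iota_smul_normalizedPacket p _ (Fin.last _) (htq0 _)

/-- `hadm` for the `q`-region at the prime: the preimage of `λ_q·𝒪_L` is admissible in the verbatim container.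
[claim: Mochizuki2012, status: disputed] -/
theorem adm_preimage_hullSet_qCentre (htq0 : ∀ x, tq x ≠ 0) (j : T.Label) :
    P.toLocalPieces.Adm j ((fun x => P.factorMap j x) ⁻¹' hullSet (P.factorField j) (P.qCentre tq j)) :=
  P.adm_preimage_of_isHullSet j ⟨_, P.qCentre_ne_zero tq htq0 j, rfl⟩

/-- The weighted log-measure of the `q`-boxes is `Σ_{v⃗} w(v⃗)·log ‖t_{q,v_j}‖`; it vanishes where the `q`-ideles are
units on the fibre. [cite: DupuyHilado2025, §3.6, §3.7] -/
theorem sum_w_mul_packetLogμ_qBox_eq_zero (htq0 : ∀ x, tq x ≠ 0) (j : T.Label) (h1 : ∀ x : T.Fibre vQ, ‖tq x‖ = 1) :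
    haveI : Fintype (T.Caps j → T.Fibre vQ) := Fintype.ofFinite _
    ∑ e : T.Caps j → T.Fibre vQ, P.w j e * packetLogμ p (P.kk e)
      (iota p (P.kk e) (Fin.last _) (tq (e (Fin.last _))) • (normalizedPacket p (P.kk e) : Set (P.X e))) = 0 :=
  Finset.sum_eq_zero fun e _ => by rw [P.packetLogμ_qBox tq htq0, h1, Real.log_one, mul_zero]

end QCentre

end PadicPresentation

end Cor312Vol

end IUTFork

end Summit.ABC

end
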